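/- Copyright: the b2b-balaban cell (near-miss cell 7), T⁴-continuum fan-out; row NE7b ROUND-2 swarm, seat
t4-ne7b-formalise-leaf-06 (gen 7) (road W-RP, sub-row «W-LAB», file 10: THE UNIFORM-SMALL-FIELD READER — `read_meas` and
`read_sym` are THEOREMS for the natural large-field cells; per cutoff only (U1)×(G2) remains; INTENT journal l.17482).
Released under the licence of the surrounding project. -/
import Summits.QuantumFields.BalabanUV.T4Continuum.Support.HistoryChessboardReaderCells
import Summits.QuantumFields.BalabanUV.T4Continuum.Support.HistoryChessboardGibbsCellsTemplates

/-!
# Road W-RP, sub-row «W-LAB», file 10: THE UNIFORM-SMALL-FIELD READER — per cutoff only the (U1)×(G2) inequality remains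

Summits-side support leaf of the T⁴-continuum cell (rung (B)+1 on a FINITE torus only; NOT infinite volume, NOT the
mass gap, NOT the Clay statement; NOT a proof of the spine estimate NE7b). Row NE7b, road **W-RP**, sub-row «W-LAB»,
file 10: the junction, BY NAME, of leaf-04 g7's W3o file 3 (`HistoryRPTowerUniform`: the uniform box template
`boxUniform P G A K M K` «every bond of the reference column of the top cube of side `M` lies in `A`», with
`measurableSet_boxUniform` and the reflection symmetry `boxUniform_sym`) and leaf-01 g9's W-2T file 3
(`HistoryChessboardGibbsCellsTemplates`: `largeBox F A K m₁` = its complement, `measurableSet_largeBox_towerBox`,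
`pow_le_sitesPerDir`, `cellSide_largeBox`) with this sub-row's READER shapes (file 8 `ReaderCellSide`, file 6
`GibbsReaderPattern` — hence file 7's reader witness `patA`∕`patB`). [folklore] bookkeeping over TREE theorems; ONE
DATA def (`smallReader`: the Boolean reader «the column is uniformly `A`-small», by classical `decide`); no
`structure`, no `[cite:]` tag, no `Prop`-valued FACT minted (c1), no constant of print (c2∕c6), no exit ∕ socket ∕
`HistoryConstants` file touched (c3); nothing of W3o ∕ W-2T ∕ files 1–9 restated; ONE EVENT, TWO ROADS: `smallReader …
⁻¹' {false} = largeBox F A K m₁` (leaf-04 g9's R1), so the reader's bad cells ARE W-2T 3's `cellSide_largeBox` cells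
by name.

WHY. Files 6∕8 display, per cutoff, FOUR clauses on an arbitrary reader `f`: `read_meas`, `read_sym`, `univ_le`, `r ≥
0`. For the NATURAL reader of Bałaban-type large-field conditions — the Boolean «every bond variable of the cube's
column (all levels `≤ K`) lies in the small set `A`», `A ⊆ G` measurable and inversion-symmetric (e.g. `{g | dist1 g <
ε}`) — the first two ARE W3o file 3's theorems. So for that reader the per-cutoff display of road W is ONE inequality:
`univ_le` = «under the Gibbs tower the event that EVERY cube's column has a large bond has probability ≤ r^(N^4)»
((U1)×(G2) in ratio currency), plus `r ≥ 0`.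

WHAT. `smallReader F A m₁ K : Tower (F.P K) G K → Bool`; its fibres (`smallReader_preimage_true` = the uniform box
template, `smallReader_preimage_false` = W-2T 3's `largeBox F A K m₁`); **`smallReader_read_meas`** (every fibre an
event of `towerBox G K (L^{m₁}) K` — `measurableSet_boxUniform`); **`smallReader_read_sym`** (pointwise reflection
symmetry — `boxUniform_sym` with `M = L^{m₁} ≤ N_K`, W-2T 3's `pow_le_sitesPerDir`); **`readerCellSide_smallReader`**:
`ReaderCellSide D g₀ hm₁ K {false} (smallReader F A m₁ K) r` from `0 ≤ r` and the ONE inequality `univ_le`;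
**`readerPattern_smallReader`**: file 6's `GibbsReaderPattern` from the same two hypotheses; hence W-2T's `CellSide`
and W7's `GibbsCubeEvents`∕`GibbsCubeSide os` BY NAME (`.cellSide`, `.side os`). §3: for Bałaban's tolerance set `{g |
dist1 g < ε}` both hypotheses hold (`measurableSet_dist1_lt` — `RegularGaugeGroup.measurable_dist1`;
`inv_mem_dist1_lt_iff` — `GaugeGroup.dist1_inv`): **`readerCellSide_dist1`**, **`readerPattern_dist1`** — the display
is ONE CONCRETE inequality per cutoff.

HONEST SCOPE (R-OWNER-23-8 wording for road W-RP). For the uniform-small-field reader the event-geometry displays of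
road W ((LOC), (R-sym), the (EXT) structural clauses) are ALL theorems; what a cutoff displays is (U1)×(G2) for THIS
reader — the chessboard-currency large-field bound «all cubes bad» ≤ r^(N^4), Σ_K r_K < ∞ — and, per string, NE7c∕NE7
on the DEFINED pattern weights (file 7) or W-2T's aggregate small-field sandwich (leaf-01 g9); and the READING that
Bałaban's large-field classes ARE «some bond of the cube's column outside `A`» with HIS `A` ((EXT) proper: in print
the terms carry 𝐑-operations and analytic continuations, not bare characteristic functions). Nothing of H3 ∕ (B) ∕
BetaPertH ∕ (U1) ∕ (G2) ∕ NE7c ∕ NE7 discharged; 0∕9 unchanged. NE7b NOT proved; spine 0∕9. HONEST DEPENDENCY (cell):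
continuum YM on T⁴ ⇐ BetaPertH ∧ nine spine estimates (0/9 proved); BetaPertH ⇐ (D1) ∧ (D4) ∧ CAP+tail; G-an2-4 gates
asym, D1 and NE2/3/4. This file changes none of it.
-/

open Finset MeasureTheory Literature.Barriers.CriticalPhenomena.NonGibbs Literature.Probability.LatticeModels
open Literature.MathematicalPhysics.QuantumFieldTheory.Balaban1983to89
open Literature.MathematicalPhysics.QuantumFieldTheory.Balaban1983to89.Missing
open Literature.MathematicalPhysics.QuantumFieldTheory.Balaban1983to89.T4Continuum
open Summit.QuantumFields.BalabanUV.T4Continuum HistoryChessboardEventsSplit HistoryChessboardEventsTower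
open HistoryChessboardEventsCubes HistoryRPTowerLaw HistoryRPTowerCuts HistoryRPTowerTemplates HistoryRPTowerUniform
open HistoryChessboardEventsTemplates HistoryChessboardTowerRepr HistoryChessboardGibbsSide HistoryChessboardLabels
open HistoryChessboardLabelsReader HistoryChessboardLabelsGibbsReader HistoryChessboardLabelsPattern
open HistoryChessboardGibbsCells HistoryChessboardReaderCells HistoryChessboardGibbsCellsTemplates

namespace Summit.QuantumFields.BalabanUV.T4Continuum.HistoryChessboardSmallFieldReader

noncomputable section

section Reader

open Classical in
/-- **THE UNIFORM-SMALL-FIELD READER** of the reference cube column (cubes of side `L^{m₁}`): `true` iff EVERY bond of the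
column under the top cube at the origin, at every level `≤ K`, carries a value in the small set `A` (W3o file 3's
`boxUniform`); `false` = «a large bond somewhere in the column» — the BAD label. -/
def smallReader (F : T4Family) {G : Type*} (A : Set G) (m₁ K : ℕ) : Tower (F.P K) G K → Bool :=
  fun ω => decide (ω ∈ boxUniform (F.P K) G A K (F.L ^ m₁) K)

variable {F : T4Family} {G : Type*} {A : Set G} {m₁ K : ℕ}

/-- the reader reads `true` exactly on the uniform box template. [folklore] -/
theorem smallReader_eq_true_iff (ω : Tower (F.P K) G K) :
    smallReader F A m₁ K ω = true ↔ ω ∈ boxUniform (F.P K) G A K (F.L ^ m₁) K := by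
  simp [smallReader]

/-- the `true`-fibre IS the uniform box template. [folklore] -/
theorem smallReader_preimage_true : smallReader F A m₁ K ⁻¹' {true} = boxUniform (F.P K) G A K (F.L ^ m₁) K :=
  Set.ext fun ω => by simp [smallReader]

/-- **ONE EVENT, TWO ROADS** (leaf-04 g9's junction remark R1): the `false`-fibre («a large bond somewhere in the
column») IS W-2T file 3's large-field box template `largeBox F A K m₁` (leaf-01 g9) — so the reader's bad cells and
`cellSide_largeBox`'s cells are the SAME sets by name. [folklore] -/
theorem smallReader_preimage_false : smallReader F A m₁ K ⁻¹' {false} = largeBox F A K m₁ :=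
  Set.ext fun ω => by simp [smallReader, largeBox]

/-- **`read_meas` IS A THEOREM for the uniform-small-field reader** (measurable `A`): every fibre is an event of the
reference cube column `towerBox G K (L^{m₁}) K` — W3o file 3's `measurableSet_boxUniform` (and its complement).
[folklore] -/
theorem smallReader_read_meas [MeasurableSpace G] (hA : MeasurableSet A) :
    ∀ l, MeasurableSet[towerBox G K (F.L ^ m₁) K] (smallReader F A m₁ K ⁻¹' {l})
  | true => by
    rw [smallReader_preimage_true]
    exact measurableSet_boxUniform hA K _ K
  | false => by
    rw [smallReader_preimage_false]
    exact measurableSet_largeBox_towerBox hA K m₁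

/-- **`read_sym` IS A THEOREM for the uniform-small-field reader** (inversion-symmetric `A`): pointwise, reading the
reflected tower = reading the tower carried to the mirror cube — W3o file 3's `boxUniform_sym` (side conditions
`pow_le_sitesPerDir` of W-2T file 3 and `K ≤ m + K`). [folklore] -/
theorem smallReader_read_sym [GaugeGroup G] (hA : ∀ g : G, g⁻¹ ∈ A ↔ g ∈ A) (hm₁ : m₁ ≤ F.m) :
    ∀ (i : Fin 4) (ω : Tower (F.P K) G K),
      smallReader F A m₁ K (towerRefl i K ω) =
        smallReader F A m₁ K (towerTranslate K (-axisVec (F.P K) K i (F.L ^ m₁)) ω) := by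
  intro i ω
  have h := Set.ext_iff.1 (boxUniform_sym (P := F.P K) (G := G) hA (pow_le_sitesPerDir hm₁ K)
    (Nat.le_add_left K F.m) i) ω
  simp only [Set.mem_preimage] at h
  by_cases hω : towerRefl i K ω ∈ boxUniform (F.P K) G A K (F.L ^ m₁) K
  · rw [(smallReader_eq_true_iff _).2 hω, (smallReader_eq_true_iff _).2 (h.1 hω)]
  · rw [Bool.eq_false_iff.2 (mt (smallReader_eq_true_iff _).1 hω),
      Bool.eq_false_iff.2 (mt (smallReader_eq_true_iff _).1 (mt h.2 hω))]

variable [GaugeGroup G] [MeasurableSpace G] [HaarData G] {D : FiniteEpsData F G} {g₀ : ℕ → ℝ} {hm₁ : m₁ ≤ F.m} {r : ℝ}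

/-- **FOR THE UNIFORM-SMALL-FIELD READER, ROAD W DISPLAYS ONE INEQUALITY PER CUTOFF**: file 8's `ReaderCellSide` (hence
W-2T's five-clause `CellSide`, W7's two-term readings) with bad label `false` from `0 ≤ r` and the (U1)×(G2) inequality
«under the Gibbs tower, EVERY cube's column has a large bond with probability ≤ r^(N^4)» ALONE — `read_meas` and
`read_sym` being the theorems above. [folklore] -/
theorem readerCellSide_smallReader (hA : MeasurableSet A) (hAi : ∀ g : G, g⁻¹ ∈ A ↔ g ∈ A) (hr : 0 ≤ r)
    (huniv : (gibbsTower D g₀ K).real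
      {ω | ∀ c : BlockIdx 4 (cubeCount F m₁),
        smallReader F A m₁ K (towerTranslate K (cubeCorner (sitesPerDir_top_eq F hm₁ K) c) ω) = false} ≤
      r ^ (cubeCount F m₁ ^ 4)) :
    ReaderCellSide D g₀ hm₁ K ({false} : Finset Bool) (smallReader F A m₁ K) r where
  read_meas l _ := smallReader_read_meas hA l
  read_sym := smallReader_read_sym hAi hm₁
  univ_le l hl := by
    rw [Finset.mem_singleton] at hl
    subst hl
    exact huniv
  r_nonneg := hr

/-- … and file 6's `GibbsReaderPattern` (canonical pattern terms) from the SAME two hypotheses (`read_meas` for every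
fibre is also a theorem). [folklore] -/
theorem readerPattern_smallReader (hA : MeasurableSet A) (hAi : ∀ g : G, g⁻¹ ∈ A ↔ g ∈ A) (hr : 0 ≤ r)
    (huniv : (gibbsTower D g₀ K).real
      {ω | ∀ c : BlockIdx 4 (cubeCount F m₁),
        smallReader F A m₁ K (towerTranslate K (cubeCorner (sitesPerDir_top_eq F hm₁ K) c) ω) = false} ≤
      r ^ (cubeCount F m₁ ^ 4)) :
    GibbsReaderPattern D g₀ hm₁ K ({false} : Finset Bool) (smallReader F A m₁ K) r where
  read_meas := smallReader_read_meas hA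
  read_sym := smallReader_read_sym hAi hm₁
  univ_le l hl := by
    rw [Finset.mem_singleton] at hl
    subst hl
    exact huniv
  r_nonneg := hr

/-- … hence W-2T's five-clause `CellSide` for the large-field cells «some bond of the cube's column outside `A`», from
the one inequality (file 8's `ReaderCellSide.cellSide`). [folklore] -/
theorem cellSide_smallReader (hA : MeasurableSet A) (hAi : ∀ g : G, g⁻¹ ∈ A ↔ g ∈ A) (hr : 0 ≤ r)
    (huniv : (gibbsTower D g₀ K).real
      {ω | ∀ c : BlockIdx 4 (cubeCount F m₁),
        smallReader F A m₁ K (towerTranslate K (cubeCorner (sitesPerDir_top_eq F hm₁ K) c) ω) = false} ≤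
      r ^ (cubeCount F m₁ ^ 4)) :
    CellSide D g₀ hm₁ K ({false} : Finset Bool)
      (fun l c => {ω | smallReader F A m₁ K (towerTranslate K (cubeCorner (sitesPerDir_top_eq F hm₁ K) c) ω) = l}) r :=
  (readerCellSide_smallReader hA hAi hr huniv).cellSide

/-- … and, for EVERY loop string, W7's eleven-clause side with CANONICAL PATTERN TERMS and DEFINED weights, from the
one inequality (file 6's `GibbsReaderPattern.side`). [folklore] -/
theorem side_smallReader (hA : MeasurableSet A) (hAi : ∀ g : G, g⁻¹ ∈ A ↔ g ∈ A) (hr : 0 ≤ r)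
    (huniv : (gibbsTower D g₀ K).real
      {ω | ∀ c : BlockIdx 4 (cubeCount F m₁),
        smallReader F A m₁ K (towerTranslate K (cubeCorner (sitesPerDir_top_eq F hm₁ K) c) ω) = false} ≤
      r ^ (cubeCount F m₁ ^ 4)) (os : List (ULoop F)) :
    GibbsCubeSide D g₀ os hm₁ K ({false} : Finset Bool) (Finset.univ : Finset (BlockIdx 4 (cubeCount F m₁) → Bool))
      (weight D g₀ os K fun p =>
        (fun ω c => smallReader F A m₁ K (towerTranslate K (cubeCorner (sitesPerDir_top_eq F hm₁ K) c) ω)) ⁻¹' {p})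
      (badPatterns {false})
      (fun p => (fun ω c => smallReader F A m₁ K (towerTranslate K (cubeCorner (sitesPerDir_top_eq F hm₁ K) c) ω)) ⁻¹' {p})
      (fun l c => {ω | smallReader F A m₁ K (towerTranslate K (cubeCorner (sitesPerDir_top_eq F hm₁ K) c) ω) = l}) r :=
  (readerPattern_smallReader hA hAi hr huniv).side os

end Reader

/-! ## §3 Bałaban's tolerance set `{g | dist1 g < ε}`: both hypotheses hold; the display is ONE concrete inequality -/

section Dist1

variable {F : T4Family} {G : Type*} [GaugeGroup G] [MeasurableSpace G] [HaarData G]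

omit [HaarData G] in
/-- the small set `{g | dist1 g < ε}` (B7 (19): `|g − 1| < ε`) is measurable for a regular gauge group. [folklore] -/
theorem measurableSet_dist1_lt [RegularGaugeGroup G] (ε : ℝ) : MeasurableSet {g : G | dist1 g < ε} :=
  measurableSet_lt RegularGaugeGroup.measurable_dist1 measurable_const

omit [MeasurableSpace G] [HaarData G] in
/-- … and inversion-symmetric (`GaugeGroup.dist1_inv`). [folklore] -/
theorem inv_mem_dist1_lt_iff (ε : ℝ) : ∀ g : G, g⁻¹ ∈ {g : G | dist1 g < ε} ↔ g ∈ {g : G | dist1 g < ε} := by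
  intro g
  simp only [Set.mem_setOf_eq, GaugeGroup.dist1_inv]

variable [RegularGaugeGroup G] {D : FiniteEpsData F G} {g₀ : ℕ → ℝ} {m₁ K : ℕ} {hm₁ : m₁ ≤ F.m} {r : ℝ}

/-- **ROAD W PER CUTOFF FOR BAŁABAN-TYPE LARGE-FIELD CELLS = ONE CONCRETE INEQUALITY**: the reader «every bond variable
`U(b)` of the cube's column (all levels `≤ K`) has `dist1 (U b) < ε`» gives file 8's `ReaderCellSide` (hence W-2T's
`CellSide`, W7's readings BY NAME) from `0 ≤ r` and
`(gibbsTower D g₀ K){every cube's column has a bond with dist1 ≥ ε} ≤ r^(N^4)` — (U1)×(G2) for THIS reader, displayed.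
[folklore] -/
theorem readerCellSide_dist1 (ε : ℝ) (hr : 0 ≤ r)
    (huniv : (gibbsTower D g₀ K).real
      {ω | ∀ c : BlockIdx 4 (cubeCount F m₁),
        smallReader F {g : G | dist1 g < ε} m₁ K (towerTranslate K (cubeCorner (sitesPerDir_top_eq F hm₁ K) c) ω) =
          false} ≤ r ^ (cubeCount F m₁ ^ 4)) :
    ReaderCellSide D g₀ hm₁ K ({false} : Finset Bool) (smallReader F {g : G | dist1 g < ε} m₁ K) r :=
  readerCellSide_smallReader (measurableSet_dist1_lt ε) (inv_mem_dist1_lt_iff ε) hr huniv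

/-- … and file 6's `GibbsReaderPattern` (canonical pattern terms ⇒ file 7's reader witness fields `patA`∕`patB`).
[folklore] -/
theorem readerPattern_dist1 (ε : ℝ) (hr : 0 ≤ r)
    (huniv : (gibbsTower D g₀ K).real
      {ω | ∀ c : BlockIdx 4 (cubeCount F m₁),
        smallReader F {g : G | dist1 g < ε} m₁ K (towerTranslate K (cubeCorner (sitesPerDir_top_eq F hm₁ K) c) ω) =
          false} ≤ r ^ (cubeCount F m₁ ^ 4)) :
    GibbsReaderPattern D g₀ hm₁ K ({false} : Finset Bool) (smallReader F {g : G | dist1 g < ε} m₁ K) r :=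
  readerPattern_smallReader (measurableSet_dist1_lt ε) (inv_mem_dist1_lt_iff ε) hr huniv

end Dist1

end

end Summit.QuantumFields.BalabanUV.T4Continuum.HistoryChessboardSmallFieldReader
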